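import Summits.ABC.IUTFork.Cor312LicenceShallowGenuineK
import HarnessLib

/-!
# R-J census, row Y-21ℓ — scope guard at GENUINE data of every level: the realising regime of parts III–V
# (`TestATS4LowerBoundGenuineRealising*`, p472542 / p473715 / p475676) has NO instance at the `L`-level pilot datum
# `pilotDataOfK D L` of an initial Θ-datum, for ANY finite extension `L ⊇ F` (in particular `L = K = F(E_F[l])`)

Proof-only record file of the abc-iut cell, branch E → R-J «Joshi Y-discharge census» (D-0079; rung LADDER-ABC:A2.RESCUE.J; seat
abc-iut-E-t59, gen 10; the `K`-LEVEL twin of abc-iut-E-cx-2's G2 rider `TestATS4LowerBoundRealisingNotInitial` (p475883)).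
**No side is taken** on [IUTchIII] Cor. 3.12 / [IUTchIV] Thm 1.10 / [IUTchI] Def. 3.1, on [J-III] Cor 9.11.1.1 / [J-IV] (unrefereed
arXiv preprints) or on any author; typed ≠ proved ≠ endorsed; instantiated ≠ endorsed; no definition, no `Prop` fact, no instance.

WHAT THIS RECORDS. Part III `TestATS4LowerBound.statement_and_not_cor91111_of_realising` (p472542) refutes the converse of row Y-21ℓ
(«OUR typed Cor. 3.12 `Statement` ⟹ Joshi's first inequality») at pilot data `X` carrying REALISING ideles, in the regime
* `hU`/`hUS` — the bad places fill the fibres over a finite set `U` of primes,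
* `hUd` — every `p ∈ U` is UNRAMIFIED in the field of `X` (`¬ p ∣ disc`), `hU2` — odd,
* `hord` — `ord_v(q_v) = 2l·e_v·m_q(p)`: the `ℚ_p`-RATIONAL realising depth (the realising ideles are then `p`-powers, `‖t_{q,v}‖ = ‖p^{m_q(p)}‖`,
  the exponent shape `hmq` of p463394's dictionary-in-numbers).
G2 (p475883, with block C's p432420) showed that NO pilot datum OF an initial Θ-datum over its own field `F` carries realising ideles at all
([IUTchI] Def. 3.1 (c): `l ∤ ord_v(q_v)`), and left in prose: «for block C's `K`-level repair `pilotDataOfK` (p434046), where `U` ramifies, the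
realising window question is not addressed by parts III/IV». Realising ideles DO exist at `pilotDataOfK D K` (abc-iut-C-cert-3
`Cor312Prov.exists_realising_qIdeles_pilotDataOfK`, [IUTchI] Ex. 3.2 (iv) as the theorem `twoMulLDvdOrdq_pilotDataOfK`). THIS FILE puts the
`K`-level clause in the kernel, for every finite extension `L ⊇ F` and `X := pilotDataOfK D L`:
* §1 `ordq_pilotDataOfK_ne_two_mul_l_mul_ramIdx_mul` (`_int`) — at every bad place `w` of `X`, `ord_w(q) ≠ 2l·e_w·m` for every
  `m : ℕ` (`m : ℤ`): the
  `ℚ_p`-rational depth `hord` is NEVER attained (`ord_w(q) = e(w|v)·ord_v(q_v)`, `e_w = e(v|p)·e(w|v)`, so `hord` would give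
  `ord_v(q_v) = 2l·e(v|p)·m`, i.e. `l ∣ ord_v(q_v)`, against Def. 3.1 (c) `InitialThetaData.l_coprime_qParamOrd`) — NO hypothesis on `L`;
  `not_hord_pilotDataOfK` — hence the pair (`hU`, `hord`) of p472542 §2 is contradictory at `X` (its `S` is non-empty);
* §2 `norm_ne_norm_zpow_of_realising_pilotDataOfK` — consequently EVERY `q`-idele realising `P_q` in print's normalisation at
  `X` (they exist at `L = K`) has `‖t_{q,w}‖ ≠ ‖p^m‖` for all `m : ℤ` at every bad `w`: the exponent shape `hmq` of the dictionary-in-numbers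
  (p463394 `qLocal_settingPrVolSharp_eq_of_exponent`, p472542 `norm_qIdele_eq_of_realising`) is unavailable at genuine data —
  `not_hmq_of_realising_pilotDataOfK`: (`hU`, `htq`, `hmq`) in their literal binder shapes prove `False`; NON-VACUITY at `L = K`:
  `exists_realising_and_norm_ne_norm_zpow_pilotDataOfK_K` (C-cert-3's realising `q`-ideles exist there, and every one fails the shape);
* §3 `exists_mem_and_dvd_discr_of_hU_pilotDataOfK` — whenever realising ideles exist at all (`TwoMulLDvdOrdq X`; automatic at `L = K`), EVERY
  prime under `S` divides `disc L` (abc-iut-w5-d054 / C-cert-2 `Cor312ProvKRamified`: `e(w|v) ≥ l ≥ 5`), so (`hU`, `hUd`) is contradictory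
  too — `not_hUd_pilotDataOfK` (any `L`, under `TwoMulLDvdOrdq`) and `not_hUd_pilotDataOfK_K` (`L = K`, unconditional);
* §4 `not_realisingRegime_pilotDataOfK` — the literal §2-hypothesis block of p472542 at `X := pilotDataOfK D L` proves `False`.
So the census word for Y-21ℓ's realising countermodels reads, in kernel at BOTH levels: «at FREE Dupuy–Hilado pilot data of the
`ℚ_p`-rational realising class over fields where `U` is unramified — a class containing NO pilot datum of an initial Θ-datum at ANY level
`L ⊇ F` (F-level: no realising ideles, G2; `L`-level: depth never `ℚ_p`-rational (§1), `U` always ramified (§3))». WHAT A GENUINE `K`-LEVEL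
TEST OF THE CONVERSE WOULD NEED (not in the tree; recorded, not claimed): (α) the dictionary-in-numbers for `K_w`-rational, non-exponent-shaped
realising ideles, and (β) EXACT (Ind1)/(Ind2)-hull log-volumes at RAMIFIED, possibly MIXED packets `⊗_{w|p} K_w` (abc-iut-c312-5 /
this seat's p470908 give lower bounds only). Nothing here touches the kernel content of parts I–V or of G2.
[cite: Mochizuki2012, IUTchI Def. 3.1 (c) p. 62, Ex. 3.2 (iv) p. 71] [cite: DupuyHilado2025, §3.3, §3.4] [cite: NeukirchANT1999, Ch. II Prop. (6.8), Ch. III (2.12)].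
Standard axioms.
-/

noncomputable section

open NumberField IsDedekindDomain

namespace Summit.ABC.IUTFork.Joshi.TestATS4LowerBound

open Thm311 Thm311.Real Cor312Prov Literature.IUT.LogVolume Literature.IUT.HodgeTheaters
  Literature.NumberTheory.NumberFields

variable {F K Fbar : Type} [Field F] [NumberField F] [Field K] [NumberField K] [Algebra F K] [Field Fbar]
  [Algebra F Fbar] [Algebra K Fbar] {E : WeierstrassCurve F} [E.IsElliptic] {l : ℕ} {Pb : BadPlacePredicates K}
  (D : InitialThetaData F K Fbar E l Pb) (L : Type) [Field L] [NumberField L] [Algebra F L]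

/-! ## 0. Plumbing: every finite place is `placeOf` of a point of the fibre over its residue characteristic -/

/-- Every finite place `w` of the field of a pilot datum `X` is `placeOf X p x` for the prime `p = char κ(w)` and some point `x` of
the fibre of `𝕍 → 𝕍_ℚ` over `p` (abc-iut-c312-5's `fibreEquivPlacesOver`), in the binder shape of the real settings. [cite: DupuyHilado2025, §3.6] -/
theorem exists_placeOf_eq {M : Type} [Field M] [NumberField M] (X : PilotData M) (w : HeightOneSpectrum (𝓞 M)) :
    ∃ (pp : Nat.Primes) (x : (thetaIndex X).Fibre (.inr pp)),
      (pp : ℕ) = residueChar M w ∧ haveI : Fact (pp : ℕ).Prime := ⟨pp.2⟩; placeOf X pp.1 x = w := by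
  set pp : Nat.Primes := ⟨residueChar M w, residueChar_prime M w⟩ with hpp
  haveI : Fact (pp : ℕ).Prime := ⟨pp.2⟩
  have hwmem : w ∈ placesOver M (pp : ℕ) := (mem_placesOver_iff_residueChar w).mpr rfl
  refine ⟨pp, (fibreEquivPlacesOver X pp).symm ⟨w, hwmem⟩, rfl, ?_⟩
  show ((fibreEquivPlacesOver X pp) ((fibreEquivPlacesOver X pp).symm ⟨w, hwmem⟩)).1 = w
  rw [Equiv.apply_symm_apply]

/-! ## 1. The `ℚ_p`-rational realising depth `hord` is never attained at `pilotDataOfK D L` -/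

/-- **`ord_w(q) ≠ 2l·e_w·m` at every bad place `w` of `pilotDataOfK D L`, every `m : ℤ`, ANY finite `L ⊇ F`.** `ord_w(q) = e(w|v)·ord_v(q_v)`
(abc-iut-C-cert-3 `Cor312Prov.ordq_pilotDataOfK`) and `e_w = e(v|p)·e(w|v)` (abc-iut-w5-d009 `Cor312Prov.ramIdx_eq_ramIdx_finBelow_mul`);
so `ord_w(q) = 2l·e_w·m` would give `ord_v(q_v) = 2l·e(v|p)·m`,
hence `l ∣ ord_v(q_v)` — excluded by [IUTchI] Def. 3.1 (c) (`InitialThetaData.l_coprime_qParamOrd`, `l` prime).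
[cite: Mochizuki2012, IUTchI Def. 3.1 (c) p. 62] [cite: NeukirchANT1999, Ch. II Prop. (6.8)] -/
theorem ordq_pilotDataOfK_ne_two_mul_l_mul_ramIdx_mul_int {w : HeightOneSpectrum (𝓞 L)} (hS : w ∈ (pilotDataOfK D L).S)
    (m : ℤ) : ((pilotDataOfK D L).ordq w : ℝ) ≠ 2 * (pilotDataOfK D L).l * ramIdx L w * m := by
  intro h
  have hv : FinitePlace.mk (finBelow F L w) ∈ D.VFbad := (mem_pilotDataOfK_S_iff D L w).mp hS
  have hcop : l.Coprime (qParamOrd E (finBelow F L w)) := by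
    have hc := D.l_coprime_qParamOrd (FinitePlace.mk (finBelow F L w)) hv
    rwa [FinitePlace.maximalIdeal_mk] at hc
  have he0 : (finBelow F L w).asIdeal.ramificationIdx' w.asIdeal ≠ 0 := ramificationIdx'_finBelow_ne_zero (F := F) L w
  rw [ordq_pilotDataOfK D L hS, pilotDataOfK_l, ramIdx_eq_ramIdx_finBelow_mul (F := F) (K := L) w] at h
  push_cast at h
  have h1 : (((finBelow F L w).asIdeal.ramificationIdx' w.asIdeal : ℕ) : ℝ) * (qParamOrd E (finBelow F L w) : ℝ) =
      ((finBelow F L w).asIdeal.ramificationIdx' w.asIdeal : ℝ) * (2 * l * ramIdx F (finBelow F L w) * m) := by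
    linear_combination h
  have h2 : (qParamOrd E (finBelow F L w) : ℝ) = 2 * l * ramIdx F (finBelow F L w) * m :=
    mul_left_cancel₀ (by exact_mod_cast he0) h1
  have h3 : (qParamOrd E (finBelow F L w) : ℤ) = 2 * l * ramIdx F (finBelow F L w) * m := by exact_mod_cast h2
  have hdvdZ : (l : ℤ) ∣ (qParamOrd E (finBelow F L w) : ℤ) := ⟨2 * ramIdx F (finBelow F L w) * m, by rw [h3]; ring⟩
  have hdvd : l ∣ qParamOrd E (finBelow F L w) := Int.natCast_dvd_natCast.mp hdvdZ
  exact D.l_prime.one_lt.ne' (Nat.Coprime.eq_one_of_dvd hcop hdvd)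

/-- The same with a natural-number depth `m : ℕ` — LITERALLY the hypothesis `hord` of p472542 `statement_and_not_cor91111_of_realising`
(`(X.ordq v : ℝ) = 2 * X.l * ramIdx F v * mq p`) read at one bad place of `X := pilotDataOfK D L`: it FAILS.
[cite: Mochizuki2012, IUTchI Def. 3.1 (c) p. 62] -/
theorem ordq_pilotDataOfK_ne_two_mul_l_mul_ramIdx_mul {w : HeightOneSpectrum (𝓞 L)} (hS : w ∈ (pilotDataOfK D L).S) (m : ℕ) :
    ((pilotDataOfK D L).ordq w : ℝ) ≠ 2 * (pilotDataOfK D L).l * ramIdx L w * m := by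
  have h := ordq_pilotDataOfK_ne_two_mul_l_mul_ramIdx_mul_int D L hS (m : ℤ)
  rwa [Int.cast_natCast] at h

/-- **The pair (`hU`, `hord`) of p472542 §2 is contradictory at `X := pilotDataOfK D L`** (every `D`, every finite `L ⊇ F`, every `U`,
every depth function `m_q`): `S ≠ ∅`, a bad place `w` is `placeOf X p x` over its residue characteristic `p ∈ U` (`hU`), and `hord` at
`(p, x)` is the excluded equation of `ordq_pilotDataOfK_ne_two_mul_l_mul_ramIdx_mul`. So parts III–V's realising regime has NO instance
at the `L`-level pilot datum of an initial Θ-datum — with NO hypothesis on ramification. [cite: Mochizuki2012, IUTchI Def. 3.1 (c) p. 62]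
[cite: DupuyHilado2025, §3.3] -/
theorem not_hord_pilotDataOfK (U : Finset Nat.Primes)
    (hU : ∀ (pp : Nat.Primes) (x : (thetaIndex (pilotDataOfK D L)).Fibre (.inr pp)),
      haveI : Fact (pp : ℕ).Prime := ⟨pp.2⟩; placeOf (pilotDataOfK D L) pp.1 x ∈ (pilotDataOfK D L).S → pp ∈ U)
    (mq : Nat.Primes → ℕ)
    (hord : ∀ (pp : Nat.Primes), pp ∈ U → ∀ (x : (thetaIndex (pilotDataOfK D L)).Fibre (.inr pp)),
      haveI : Fact (pp : ℕ).Prime := ⟨pp.2⟩;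
      ((pilotDataOfK D L).ordq (placeOf (pilotDataOfK D L) pp.1 x) : ℝ) =
        2 * (pilotDataOfK D L).l * ramIdx L (placeOf (pilotDataOfK D L) pp.1 x) * mq pp) : False := by
  obtain ⟨w, hw⟩ := (pilotDataOfK D L).S_nonempty
  obtain ⟨pp, x, -, hx⟩ := exists_placeOf_eq (pilotDataOfK D L) w
  haveI : Fact (pp : ℕ).Prime := ⟨pp.2⟩
  have hxS : placeOf (pilotDataOfK D L) pp.1 x ∈ (pilotDataOfK D L).S := by rw [hx]; exact hw
  have h := hord pp (hU pp x hxS) x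
  rw [hx] at h
  exact ordq_pilotDataOfK_ne_two_mul_l_mul_ramIdx_mul D L hw (mq pp) h

/-! ## 2. No realising `q`-idele at genuine data is exponent-shaped -/

/-- **Realising `q`-ideles at `pilotDataOfK D L` are never `p`-powers in norm.** If `t_q` realises `P_q` in print's normalisation at
`X := pilotDataOfK D L` (`log ‖t_{q,w}‖ = −P_q(w)·log N(w)/n_w`, the hypothesis `htq` of the real settings; such ideles EXIST at `L = K`,
abc-iut-C-cert-3 `exists_realising_qIdeles_pilotDataOfK`), then at every bad place `w` over `p`: `‖t_{q,w}‖ ≠ ‖p^m‖` for every `m : ℤ`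
(`‖t_{q,w}‖ = p^{−ord_w(q)/(2l·e_w)}` and `ord_w(q)/(2l·e_w) ∉ ℤ` by §1). So the exponent shape `hmq` of the dictionary-in-numbers
(p463394 `qLocal_settingPrVolSharp_eq_of_exponent`, p472542 `norm_qIdele_eq_of_realising`) is unavailable at genuine data of any level.
[cite: Mochizuki2012, IUTchI Def. 3.1 (c) p. 62] [cite: DupuyHilado2025, §3.3, §3.4] -/
theorem norm_ne_norm_zpow_of_realising_pilotDataOfK
    (tq : ∀ (pp : Nat.Primes) (x : (thetaIndex (pilotDataOfK D L)).Fibre (.inr pp)),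
      haveI : Fact (pp : ℕ).Prime := ⟨pp.2⟩; kOf (pilotDataOfK D L) pp.1 x)
    (htq : ∀ (pp : Nat.Primes) (x : (thetaIndex (pilotDataOfK D L)).Fibre (.inr pp)),
      haveI : Fact (pp : ℕ).Prime := ⟨pp.2⟩;
      Real.log ‖tq pp x‖ = -((pilotDataOfK D L).qPilot (placeOf (pilotDataOfK D L) pp.1 x)) *
        logNorm L (placeOf (pilotDataOfK D L) pp.1 x) / localDegree L (placeOf (pilotDataOfK D L) pp.1 x))
    (pp : Nat.Primes) (x : (thetaIndex (pilotDataOfK D L)).Fibre (.inr pp))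
    (hx : haveI : Fact (pp : ℕ).Prime := ⟨pp.2⟩; placeOf (pilotDataOfK D L) pp.1 x ∈ (pilotDataOfK D L).S) (m : ℤ) :
    haveI : Fact (pp : ℕ).Prime := ⟨pp.2⟩; ‖tq pp x‖ ≠ ‖((pp : ℕ) : ℚ_[pp]) ^ m‖ := by
  haveI : Fact (pp : ℕ).Prime := ⟨pp.2⟩
  intro h
  have hres : residueChar L (placeOf (pilotDataOfK D L) pp.1 x) = pp :=
    (mem_placesOver_iff_residueChar _).mp (placeOf_mem (pilotDataOfK D L) pp.1 x)
  have hp : (0 : ℝ) < Real.log (pp : ℕ) := Real.log_pos (by exact_mod_cast pp.2.one_lt)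
  have hf : (resDeg L (placeOf (pilotDataOfK D L) pp.1 x) : ℝ) ≠ 0 := by exact_mod_cast resDeg_ne_zero L _
  have he : (ramIdx L (placeOf (pilotDataOfK D L) pp.1 x) : ℝ) ≠ 0 := by exact_mod_cast ramIdx_ne_zero L _
  have hl : ((pilotDataOfK D L).l : ℝ) ≠ 0 := by rw [pilotDataOfK_l]; exact_mod_cast D.l_prime.ne_zero
  have hlog := htq pp x
  rw [h, Padic.norm_p_zpow, Real.log_zpow, (pilotDataOfK D L).qPilot_apply_of_mem hx, logNorm_eq, hres] at hlog
  unfold localDegree at hlog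
  push_cast at hlog
  -- `hlog : (-m)·log p = −(ord_w(q)/(2l))·(f·log p)/(e·f)`; clear the (non-zero) denominators and the factor `f·log p`
  have key : (((pilotDataOfK D L).ordq (placeOf (pilotDataOfK D L) pp.1 x) : ℝ)) =
      2 * (pilotDataOfK D L).l * ramIdx L (placeOf (pilotDataOfK D L) pp.1 x) * m := by
    have h1 := hlog
    field_simp at h1
    linear_combination h1
  exact ordq_pilotDataOfK_ne_two_mul_l_mul_ramIdx_mul_int D L hx m key

/-- **Hence (`hU`, `htq`, `hmq`) is contradictory at `X := pilotDataOfK D L`**: a `q`-idele that REALISES `P_q` (`htq`, print's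
normalisation) cannot also have the exponent shape `hmq` of p463394 `TestATS4LowerBound.cor91111_iff_gap_nonpos` /
`statement_iff_gap_le_trivial` (`‖t_{q,v}‖ = ‖p^{m_q(p)}‖` over `U`) once the bad places lie over `U` (`hU`) — literal binder shapes, any `D`,
any finite `L ⊇ F`. [cite: Mochizuki2012, IUTchI Def. 3.1 (c) p. 62] [cite: DupuyHilado2025, §3.3, §3.4] -/
theorem not_hmq_of_realising_pilotDataOfK (U : Finset Nat.Primes)
    (hU : ∀ (pp : Nat.Primes) (x : (thetaIndex (pilotDataOfK D L)).Fibre (.inr pp)),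
      haveI : Fact (pp : ℕ).Prime := ⟨pp.2⟩; placeOf (pilotDataOfK D L) pp.1 x ∈ (pilotDataOfK D L).S → pp ∈ U)
    (tq : ∀ (pp : Nat.Primes) (x : (thetaIndex (pilotDataOfK D L)).Fibre (.inr pp)),
      haveI : Fact (pp : ℕ).Prime := ⟨pp.2⟩; kOf (pilotDataOfK D L) pp.1 x)
    (htq : ∀ (pp : Nat.Primes) (x : (thetaIndex (pilotDataOfK D L)).Fibre (.inr pp)),
      haveI : Fact (pp : ℕ).Prime := ⟨pp.2⟩;
      Real.log ‖tq pp x‖ = -((pilotDataOfK D L).qPilot (placeOf (pilotDataOfK D L) pp.1 x)) *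
        logNorm L (placeOf (pilotDataOfK D L) pp.1 x) / localDegree L (placeOf (pilotDataOfK D L) pp.1 x))
    (mq : Nat.Primes → ℕ)
    (hmq : ∀ (pp : Nat.Primes), pp ∈ U → ∀ (x : (thetaIndex (pilotDataOfK D L)).Fibre (.inr pp)),
      haveI : Fact (pp : ℕ).Prime := ⟨pp.2⟩; ‖tq pp x‖ = ‖((pp : ℕ) : ℚ_[pp]) ^ ((mq pp : ℕ) : ℤ)‖) : False := by
  obtain ⟨w, hw⟩ := (pilotDataOfK D L).S_nonempty
  obtain ⟨pp, x, -, hx⟩ := exists_placeOf_eq (pilotDataOfK D L) w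
  haveI : Fact (pp : ℕ).Prime := ⟨pp.2⟩
  have hxS : placeOf (pilotDataOfK D L) pp.1 x ∈ (pilotDataOfK D L).S := by rw [hx]; exact hw
  exact norm_ne_norm_zpow_of_realising_pilotDataOfK D L tq htq pp x hxS ((mq pp : ℕ) : ℤ) (hmq pp (hU pp x hxS) x)

/-- **NON-VACUITY at `L = K`**: realising `q`-ideles EXIST at `pilotDataOfK D K` (abc-iut-C-cert-3 `exists_realising_qIdeles_pilotDataOfK`,
[IUTchI] Ex. 3.2 (iv) as a theorem), they are units off `S`, and EVERY one of them fails the exponent shape at every bad place: §2 speaks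
about an inhabited class. [cite: Mochizuki2012, IUTchI Ex. 3.2 (iv) p. 71] [cite: DupuyHilado2025, §3.4] -/
theorem exists_realising_and_norm_ne_norm_zpow_pilotDataOfK_K :
    (∃ tq : ∀ (pp : Nat.Primes) (x : (thetaIndex (pilotDataOfK D K)).Fibre (.inr pp)),
        haveI : Fact (pp : ℕ).Prime := ⟨pp.2⟩; kOf (pilotDataOfK D K) pp.1 x,
      (∀ pp x, tq pp x ≠ 0) ∧
      ∀ (pp : Nat.Primes) (x : (thetaIndex (pilotDataOfK D K)).Fibre (.inr pp)),
        haveI : Fact (pp : ℕ).Prime := ⟨pp.2⟩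
        Real.log ‖tq pp x‖ = -((pilotDataOfK D K).qPilot (placeOf (pilotDataOfK D K) pp.1 x)) *
          logNorm K (placeOf (pilotDataOfK D K) pp.1 x) / localDegree K (placeOf (pilotDataOfK D K) pp.1 x)) ∧
    ∀ (tq : ∀ (pp : Nat.Primes) (x : (thetaIndex (pilotDataOfK D K)).Fibre (.inr pp)),
        haveI : Fact (pp : ℕ).Prime := ⟨pp.2⟩; kOf (pilotDataOfK D K) pp.1 x),
      (∀ (pp : Nat.Primes) (x : (thetaIndex (pilotDataOfK D K)).Fibre (.inr pp)),
        haveI : Fact (pp : ℕ).Prime := ⟨pp.2⟩;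
        Real.log ‖tq pp x‖ = -((pilotDataOfK D K).qPilot (placeOf (pilotDataOfK D K) pp.1 x)) *
          logNorm K (placeOf (pilotDataOfK D K) pp.1 x) / localDegree K (placeOf (pilotDataOfK D K) pp.1 x)) →
      ∀ (pp : Nat.Primes) (x : (thetaIndex (pilotDataOfK D K)).Fibre (.inr pp)),
        haveI : Fact (pp : ℕ).Prime := ⟨pp.2⟩;
        placeOf (pilotDataOfK D K) pp.1 x ∈ (pilotDataOfK D K).S → ∀ m : ℤ, ‖tq pp x‖ ≠ ‖((pp : ℕ) : ℚ_[pp]) ^ m‖ := by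
  refine ⟨?_, fun tq htq pp x hx m => norm_ne_norm_zpow_of_realising_pilotDataOfK D K tq htq pp x hx m⟩
  obtain ⟨tq, htq0, -, htq⟩ := exists_realising_qIdeles_pilotDataOfK D
  exact ⟨tq, htq0, htq⟩

/-! ## 3. Whenever realising ideles exist at all, every prime under `S` is RAMIFIED in `L`: `hUd` fails too -/

/-- **Under `TwoMulLDvdOrdq (pilotDataOfK D L)` (the condition for realising ideles to exist; a THEOREM at `L = K`), the pair (`hU`, `hUd`)
of p472542 §2 is contradictory**: a bad place `w` lies over its residue characteristic `p ∈ U` (`hU`), and `p ∣ disc L` (abc-iut-C-cert-2 /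
w5-d054 `Cor312Prov.natCast_dvd_discr_of_mem_S_of_twoMulLDvdOrdq`: `e(w|v) ≥ l ≥ 5`, Dedekind). Returned as the witness `∃ p ∈ U, p ∣ disc L`.
[cite: Mochizuki2012, IUTchI Def. 3.1 (c) p. 62, Ex. 3.2 (iv) p. 71] [cite: NeukirchANT1999, Ch. III (2.12)] -/
theorem exists_mem_and_dvd_discr_of_hU_pilotDataOfK (hreal : TwoMulLDvdOrdq (pilotDataOfK D L)) (U : Finset Nat.Primes)
    (hU : ∀ (pp : Nat.Primes) (x : (thetaIndex (pilotDataOfK D L)).Fibre (.inr pp)),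
      haveI : Fact (pp : ℕ).Prime := ⟨pp.2⟩; placeOf (pilotDataOfK D L) pp.1 x ∈ (pilotDataOfK D L).S → pp ∈ U) :
    ∃ pp ∈ U, ((pp : ℕ) : ℤ) ∣ NumberField.discr L := by
  obtain ⟨w, hw⟩ := (pilotDataOfK D L).S_nonempty
  obtain ⟨pp, x, -, hx⟩ := exists_placeOf_eq (pilotDataOfK D L) w
  haveI : Fact (pp : ℕ).Prime := ⟨pp.2⟩
  have hxS : placeOf (pilotDataOfK D L) pp.1 x ∈ (pilotDataOfK D L).S := by rw [hx]; exact hw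
  exact ⟨pp, hU pp x hxS, natCast_dvd_discr_of_mem_S_of_twoMulLDvdOrdq D L hreal pp.1
    (natCast_mem_placeOf (pilotDataOfK D L) pp.1 x) hxS⟩

/-- Hence (`hU`, `hUd`) proves `False` at `X := pilotDataOfK D L` under `TwoMulLDvdOrdq X`, any finite `L ⊇ F`.
[cite: Mochizuki2012, IUTchI Ex. 3.2 (iv) p. 71] [cite: NeukirchANT1999, Ch. III (2.12)] -/
theorem not_hUd_pilotDataOfK (hreal : TwoMulLDvdOrdq (pilotDataOfK D L)) (U : Finset Nat.Primes)
    (hU : ∀ (pp : Nat.Primes) (x : (thetaIndex (pilotDataOfK D L)).Fibre (.inr pp)),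
      haveI : Fact (pp : ℕ).Prime := ⟨pp.2⟩; placeOf (pilotDataOfK D L) pp.1 x ∈ (pilotDataOfK D L).S → pp ∈ U)
    (hUd : ∀ pp ∈ U, ¬ ((pp : ℕ) : ℤ) ∣ NumberField.discr L) : False := by
  obtain ⟨pp, hpp, hdvd⟩ := exists_mem_and_dvd_discr_of_hU_pilotDataOfK D L hreal U hU
  exact hUd pp hpp hdvd

/-- **At the Θ-datum's own `K = F(E_F[l])` this is unconditional**: `TwoMulLDvdOrdq (pilotDataOfK D K)` is abc-iut-C-cert-3's theorem
`twoMulLDvdOrdq_pilotDataOfK` ([IUTchI] Ex. 3.2 (iv)), so (`hU`, `hUd`) is contradictory at `pilotDataOfK D K` for EVERY initial Θ-datum —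
the `K`-level half of G2's prose clause «`pilotDataOfK`, where `U` ramifies». [cite: Mochizuki2012, IUTchI Ex. 3.2 (iv) p. 71] -/
theorem not_hUd_pilotDataOfK_K (U : Finset Nat.Primes)
    (hU : ∀ (pp : Nat.Primes) (x : (thetaIndex (pilotDataOfK D K)).Fibre (.inr pp)),
      haveI : Fact (pp : ℕ).Prime := ⟨pp.2⟩; placeOf (pilotDataOfK D K) pp.1 x ∈ (pilotDataOfK D K).S → pp ∈ U)
    (hUd : ∀ pp ∈ U, ¬ ((pp : ℕ) : ℤ) ∣ NumberField.discr K) : False :=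
  not_hUd_pilotDataOfK D K (twoMulLDvdOrdq_pilotDataOfK D) U hU hUd

/-! ## 4. The literal §2-hypothesis block of p472542 at `X := pilotDataOfK D L` -/

/-- **The realising regime of parts III–V is VOID at the `L`-level pilot datum of every initial Θ-datum.** The arithmetic hypothesis
block of p472542 `TestATS4LowerBound.statement_and_not_cor91111_of_realising` — `hU`, `hUS`, `hU2`, `hUd`, `mq`, `hord`, in its literal
binder shapes — specialised to `X := pilotDataOfK D L` (any `D`, any finite `L ⊇ F`) proves `False`; already (`hU`, `hord`) does (§1), and
at `L = K` independently (`hU`, `hUd`) does (§3). What a genuine `K`-level test of the Y-21ℓ converse needs instead is recorded in the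
module docstring ((α) non-exponent-shaped realising ideles — §2 —, (β) exact ramified mixed-packet hull volumes); nothing is claimed about it.
[cite: Mochizuki2012, IUTchI Def. 3.1 (c) p. 62, Ex. 3.2 (iv) p. 71] [cite: DupuyHilado2025, §3.3, §3.4] -/
theorem not_realisingRegime_pilotDataOfK (U : Finset Nat.Primes)
    (hU : ∀ (pp : Nat.Primes) (x : (thetaIndex (pilotDataOfK D L)).Fibre (.inr pp)),
      haveI : Fact (pp : ℕ).Prime := ⟨pp.2⟩; placeOf (pilotDataOfK D L) pp.1 x ∈ (pilotDataOfK D L).S → pp ∈ U)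
    (_hUS : ∀ (pp : Nat.Primes), pp ∈ U → ∀ (x : (thetaIndex (pilotDataOfK D L)).Fibre (.inr pp)),
      haveI : Fact (pp : ℕ).Prime := ⟨pp.2⟩; placeOf (pilotDataOfK D L) pp.1 x ∈ (pilotDataOfK D L).S)
    (_hU2 : ∀ pp ∈ U, 2 < (pp : ℕ)) (_hUd : ∀ pp ∈ U, ¬ ((pp : ℕ) : ℤ) ∣ NumberField.discr L)
    (mq : Nat.Primes → ℕ)
    (hord : ∀ (pp : Nat.Primes), pp ∈ U → ∀ (x : (thetaIndex (pilotDataOfK D L)).Fibre (.inr pp)),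
      haveI : Fact (pp : ℕ).Prime := ⟨pp.2⟩;
      ((pilotDataOfK D L).ordq (placeOf (pilotDataOfK D L) pp.1 x) : ℝ) =
        2 * (pilotDataOfK D L).l * ramIdx L (placeOf (pilotDataOfK D L) pp.1 x) * mq pp) : False :=
  not_hord_pilotDataOfK D L U hU mq hord

end Summit.ABC.IUTFork.Joshi.TestATS4LowerBound

end
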